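import Summits.AtomisticToContinuum.FouriersLaw.Theorems.EmbeddedDrudeMourreDrudeDissolutionStubFreeForceKernelThreeOneGap
import Literature.MathematicalPhysics.KineticTheory.HarmonicChaosDecomposition
import HarnessLib

/-!
# Stub K `stub_freeForceKernel`, the far chaos sectors are gapped away from frequency `0`
(line `gram-pencil-harmonic-chaos`, crux `EmbeddedDrudeMourre.DrudeDissolution`,
item stmt-AtomisticToContinuum-12593; `--supports` file, closes nothing)

WHAT. In the chaos picture of the harmonic chain (`HarmonicChaosDecomposition.lean`: sectors
`(m, n)` of `m` created and `n` annihilated phonons on the zero-momentum shells `Shell m n`, free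
frequencies `Ω_{m,n} = sectorPhase ω₂`), the spectral measure of a vector `Ψ ∈ 𝔉` under the free
Koopman group `exp(itΩ)` is the sum over sectors of the push-forwards `(Ω_{m,n})_* (‖Ψ_{m,n}‖² σ_{m,n})`.
The first-order force `Φ` of stub K is an EVEN local polynomial of degree `4`, so its chaos vector lives
on the sectors with `m + n ∈ {2, 4}`:
`(2,0), (1,1), (0,2), (4,0), (3,1), (2,2), (1,3), (0,4)`.
This file proves that on all of them except the one-phonon-charge sector `(1,1)` (where `Ω ≡ 0` and the
component of `Φ` vanishes) and the pair sector `(2,2)` (the two-phonon threshold, the support of the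
Fermi-golden-rule density) the free frequency is bounded away from `0` UNIFORMLY on the shell, by the
explicit constant of the `(3,1)` gap,

  `c(ω₂) = 8ω₂ / (√(9ω₂ + 36) + √(ω₂ + 36)) ≤ |Ω_{m,n}(κ)|`   (`sectorPhase_far_gap`),

and records the consequence in the form consumed by the landed reduction
`stub_freeForceKernel_of_windowDensity`: the push-forward under `Ω_{m,n}` of ANY measure on a far
shell has no mass in the window `(−δ, δ)`, `δ ≤ c(ω₂)` (`map_sectorPhase_restrict_window_eq_zero`), so a
spectral measure written as "pair-sector part + far-sector parts" has, on that window, exactly the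
density of its pair-sector part (`restrict_window_sum_far`, `window_density_of_near_add_far`).

HOW. `(m,0)`/`(0,m)`: every band value is `≥ √ω₂`, so `|Ω| ≥ m√ω₂ ≥ 2√ω₂ ≥ c(ω₂)`
(`three_one_gap_const_le_two_sqrt`). `(3,1)`: on the shell the annihilated momentum is
`k' = k₁ + k₂ + k₃` in `𝕋 = ℝ/2πℤ`; lifting to real representatives this is the landed
`dispersion_three_one_gap` (`dispersion_three_one_gap_circle`). `(1,3)`: the flip
`(k; k') ↦ (−k'; −k)` reverses the sign of `Ω` (`sectorPhase_shellFlip`).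
-/

noncomputable section

open MeasureTheory Filter Set Function Topology
open scoped InnerProductSpace ENNReal
open Literature.MathematicalPhysics.KineticTheory
open Literature.MathematicalPhysics.KineticTheory.HeatConduction
open Literature.MathematicalPhysics.KineticTheory.HeatConduction.HarmonicChaos
open Literature.MathematicalPhysics.KineticTheory.HeatConduction.PinnedChainKinetic

namespace Summit.AtomisticToContinuum.FouriersLaw.Theorems.DrudeDissolution.GramPencilHarmonicChaos

/-! ## The gap constant against the two-phonon floor -/

/-- The `(3,1)` gap constant is below the two-phonon floor: `c(ω₂) ≤ 2√ω₂` (`ω₂ > 0`), because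
`√(9ω₂+36) + √(ω₂+36) ≥ 3√ω₂ + √ω₂`. [folklore] -/
theorem three_one_gap_const_le_two_sqrt {ω₂ : ℝ} (hω : 0 < ω₂) :
    8 * ω₂ / (Real.sqrt (9 * ω₂ + 36) + Real.sqrt (ω₂ + 36)) ≤ 2 * Real.sqrt ω₂ := by
  have hs : 0 < Real.sqrt ω₂ := Real.sqrt_pos.2 hω
  have hsq : Real.sqrt ω₂ ^ 2 = ω₂ := Real.sq_sqrt hω.le
  have h9 : Real.sqrt (9 * ω₂) = 3 * Real.sqrt ω₂ := by
    rw [show (9 : ℝ) * ω₂ = (3 * Real.sqrt ω₂) ^ 2 by nlinarith [hsq]]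
    exact Real.sqrt_sq (by positivity)
  have h1 : 3 * Real.sqrt ω₂ ≤ Real.sqrt (9 * ω₂ + 36) := by
    rw [← h9]
    exact Real.sqrt_le_sqrt (by linarith)
  have h2 : Real.sqrt ω₂ ≤ Real.sqrt (ω₂ + 36) := Real.sqrt_le_sqrt (by linarith)
  have hden : 4 * Real.sqrt ω₂ ≤ Real.sqrt (9 * ω₂ + 36) + Real.sqrt (ω₂ + 36) := by linarith
  rw [div_le_iff₀ (by positivity)]
  calc 8 * ω₂ = 2 * Real.sqrt ω₂ * (4 * Real.sqrt ω₂) := by nlinarith [hsq]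
    _ ≤ 2 * Real.sqrt ω₂ * (Real.sqrt (9 * ω₂ + 36) + Real.sqrt (ω₂ + 36)) :=
        mul_le_mul_of_nonneg_left hden (by positivity)

/-! ## The gap, sector by sector -/

/-- Created-only sectors `(m, 0)`: `Ω_{m,0} = Σ_i ω(k_i) ≥ m√ω₂`. [folklore] -/
theorem sectorPhase_cr_only_ge (ω₂ : ℝ) (m : ℕ) (κ : Shell m 0) :
    (m : ℝ) * Real.sqrt ω₂ ≤ sectorPhase ω₂ κ := by
  unfold sectorPhase
  rw [Finset.univ_eq_empty (α := Fin 0), Finset.sum_empty, sub_zero]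
  have h : ∀ i ∈ (Finset.univ : Finset (Fin m)), Real.sqrt ω₂ ≤ dispersion ω₂ ((κ : SectorConfig m 0).1 i) :=
    fun i _ => sqrt_le_dispersion ω₂ _
  have := Finset.card_nsmul_le_sum _ _ _ h
  simpa [nsmul_eq_mul] using this

/-- Annihilated-only sectors `(0, n)`: `Ω_{0,n} = −Σ_j ω(k'_j) ≤ −n√ω₂`. [folklore] -/
theorem sectorPhase_an_only_le (ω₂ : ℝ) (n : ℕ) (κ : Shell 0 n) :
    sectorPhase ω₂ κ ≤ -((n : ℝ) * Real.sqrt ω₂) := by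
  have h := sectorPhase_cr_only_ge ω₂ n (shellFlip 0 n κ)
  rw [sectorPhase_shellFlip] at h
  linarith

/-- The `(3,1)` non-resonance gap on the circle: for `k₁, k₂, k₃ ∈ 𝕋 = ℝ/2πℤ`,
`c(ω₂) ≤ ω(k₁) + ω(k₂) + ω(k₃) − ω(k₁ + k₂ + k₃)` (the landed real-variable statement
`dispersion_three_one_gap`, descended to the quotient). [folklore] -/
theorem dispersion_three_one_gap_circle {ω₂ : ℝ} (hω : 0 < ω₂) (k₁ k₂ k₃ : 𝕋) :
    8 * ω₂ / (Real.sqrt (9 * ω₂ + 36) + Real.sqrt (ω₂ + 36)) ≤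
      dispersion ω₂ k₁ + dispersion ω₂ k₂ + dispersion ω₂ k₃ - dispersion ω₂ (k₁ + k₂ + k₃) := by
  induction k₁ using QuotientAddGroup.induction_on
  induction k₂ using QuotientAddGroup.induction_on
  induction k₃ using QuotientAddGroup.induction_on
  rename_i x₁ x₂ x₃
  have h := dispersion_three_one_gap ω₂ hω x₁ x₂ x₃
  have e : ((x₁ : 𝕋) + (x₂ : 𝕋) + (x₃ : 𝕋)) = ((x₁ + x₂ + x₃ : ℝ) : 𝕋) := by
    rw [AddCircle.coe_add, AddCircle.coe_add]
  rw [e, dispersion_coe, dispersion_coe, dispersion_coe, dispersion_coe]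
  exact h

/-- The sector `(3,1)`: on the zero-momentum shell `k' = k₁ + k₂ + k₃`, so
`Ω_{3,1} = ω(k₁) + ω(k₂) + ω(k₃) − ω(k₁+k₂+k₃) ≥ c(ω₂)`. [folklore] -/
theorem sectorPhase_three_one_ge {ω₂ : ℝ} (hω : 0 < ω₂) (κ : Shell 3 1) :
    8 * ω₂ / (Real.sqrt (9 * ω₂ + 36) + Real.sqrt (ω₂ + 36)) ≤ sectorPhase ω₂ κ := by
  have hκ := (mem_shell_iff (κ : SectorConfig 3 1)).1 κ.2
  rw [Fin.sum_univ_three, Fin.sum_univ_one, sub_eq_zero] at hκ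
  unfold sectorPhase
  rw [Fin.sum_univ_three, Fin.sum_univ_one, ← hκ]
  exact dispersion_three_one_gap_circle hω _ _ _

/-- The sector `(1,3)`: `Ω_{1,3} ≤ −c(ω₂)` (flip of `(3,1)`). [folklore] -/
theorem sectorPhase_one_three_le {ω₂ : ℝ} (hω : 0 < ω₂) (κ : Shell 1 3) :
    sectorPhase ω₂ κ ≤ -(8 * ω₂ / (Real.sqrt (9 * ω₂ + 36) + Real.sqrt (ω₂ + 36))) := by
  have h := sectorPhase_three_one_ge hω (shellFlip 1 3 κ)
  rw [sectorPhase_shellFlip] at h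
  linarith

/-! ## The gap on all far sectors of an even quartic observable -/

/-- **Registered helper (stub K): the far chaos sectors are gapped away from frequency `0`.**
For `ω₂ > 0` and every sector label `s = (m, n)` with `m + n ∈ {2, 4}` other than the
one-phonon-charge sector `(1,1)` and the pair sector `(2,2)` — i.e. `s ∈ {(2,0), (0,2), (4,0), (3,1),
(1,3), (0,4)}`, the sectors met by an even local polynomial of degree `4` such as the first-order force
`Φ` of stub K — the free frequency satisfies `c(ω₂) ≤ |Ω_s(κ)|` for EVERY point `κ` of the zero-momentum
shell, `c(ω₂) = 8ω₂/(√(9ω₂+36) + √(ω₂+36)) > 0`. [folklore] -/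
theorem sectorPhase_far_gap : ∀ (ω₂ : ℝ), 0 < ω₂ → ∀ (s : Literature.MathematicalPhysics.KineticTheory.HeatConduction.HarmonicChaos.SectorIndex), (s.cr + s.an = 2 ∨ s.cr + s.an = 4) → s.1 ≠ (1, 1) → s.1 ≠ (2, 2) → ∀ (κ : Literature.MathematicalPhysics.KineticTheory.HeatConduction.HarmonicChaos.Shell s.cr s.an), 8 * ω₂ / (Real.sqrt (9 * ω₂ + 36) + Real.sqrt (ω₂ + 36)) ≤ |Literature.MathematicalPhysics.KineticTheory.HeatConduction.HarmonicChaos.sectorPhase ω₂ κ| := by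
  intro ω₂ hω s hs h11 h22 κ
  obtain ⟨⟨m, n⟩, hmn⟩ := s
  simp only [SectorIndex.cr, SectorIndex.an] at hs κ h11 h22 ⊢
  have hc2 := three_one_gap_const_le_two_sqrt hω
  have hs0 : 0 ≤ Real.sqrt ω₂ := Real.sqrt_nonneg _
  have hm : m ≤ 4 := by omega
  interval_cases m
  · -- m = 0 : n = 2 or n = 4
    have h := sectorPhase_an_only_le ω₂ n κ
    have hn : (2 : ℝ) ≤ n := by
      rcases hs with h2 | h4
      · simp only [zero_add] at h2; subst h2; norm_num
      · simp only [zero_add] at h4; subst h4; norm_num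
    rw [abs_of_nonpos (by nlinarith)]
    nlinarith
  · -- m = 1 : n = 1 (excluded) or n = 3
    rcases hs with h2 | h4
    · exfalso; apply h11; congr 1; omega
    · obtain rfl : n = 3 := by omega
      have h := sectorPhase_one_three_le hω κ
      have hc0 : 0 < 8 * ω₂ / (Real.sqrt (9 * ω₂ + 36) + Real.sqrt (ω₂ + 36)) :=
        three_one_gap_const_pos hω
      rw [abs_of_nonpos (by linarith)]
      linarith
  · -- m = 2 : n = 0 or n = 2 (excluded)
    rcases hs with h2 | h4
    · obtain rfl : n = 0 := by omega
      have h := sectorPhase_cr_only_ge ω₂ 2 κ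
      push_cast at h
      rw [abs_of_nonneg (by nlinarith)]
      linarith
    · exfalso; apply h22; congr 1; omega
  · -- m = 3 : n = 1
    obtain rfl : n = 1 := by omega
    have h := sectorPhase_three_one_ge hω κ
    have hc0 : 0 < 8 * ω₂ / (Real.sqrt (9 * ω₂ + 36) + Real.sqrt (ω₂ + 36)) :=
      three_one_gap_const_pos hω
    rw [abs_of_nonneg (by linarith)]
    exact h
  · -- m = 4 : n = 0
    obtain rfl : n = 0 := by omega
    have h := sectorPhase_cr_only_ge ω₂ 4 κ
    push_cast at h
    rw [abs_of_nonneg (by nlinarith)]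
    nlinarith

/-! ## The window form consumed by `stub_freeForceKernel_of_windowDensity` -/

/-- **Far sectors carry no spectral mass near frequency `0`.** For a far sector `s` as in
`sectorPhase_far_gap`, ANY measure `ν` on its shell (e.g. `‖Ψ_s‖² σ_s` for a chaos vector `Ψ`) pushes
forward under `Ω_s` to a measure vanishing on the window `(−δ, δ)`, `δ ≤ c(ω₂)`. [folklore] -/
theorem map_sectorPhase_restrict_window_eq_zero {ω₂ : ℝ} (hω : 0 < ω₂) (s : SectorIndex)
    (hs : s.cr + s.an = 2 ∨ s.cr + s.an = 4) (h11 : s.1 ≠ (1, 1)) (h22 : s.1 ≠ (2, 2))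
    (ν : Measure (Shell s.cr s.an)) {δ : ℝ}
    (hδ : δ ≤ 8 * ω₂ / (Real.sqrt (9 * ω₂ + 36) + Real.sqrt (ω₂ + 36))) :
    (ν.map (sectorPhase ω₂)).restrict (Set.Ioo (-δ) δ) = 0 := by
  rw [Measure.restrict_eq_zero, Measure.map_apply (measurable_sectorPhase ω₂ _ _) measurableSet_Ioo]
  have hempty : (sectorPhase ω₂ : Shell s.cr s.an → ℝ) ⁻¹' Set.Ioo (-δ) δ = ∅ := by
    ext κ
    simp only [mem_preimage, mem_Ioo, mem_empty_iff_false, iff_false, not_and, not_lt]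
    intro h1
    have hg := sectorPhase_far_gap ω₂ hω s hs h11 h22 κ
    have : δ ≤ |sectorPhase ω₂ κ| := hδ.trans hg
    rcases le_abs'.1 this with h | h
    · linarith
    · exact h
  rw [hempty, measure_empty]

/-- **Window restriction of a sector sum.** If a measure on `ℝ` is a finite sum of sector
contributions `m = Σ_{s ∈ S} m_s` and every `m_s` with `s ≠ s₀` vanishes on the window `(−δ, δ)`, then
on that window `m` IS `m_{s₀}` (or `0` if `s₀ ∉ S`). [folklore] -/
theorem restrict_window_sum_far {ι : Type*} [DecidableEq ι] (S : Finset ι) (m : ι → Measure ℝ) (s₀ : ι)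
    {δ : ℝ} (hfar : ∀ s ∈ S, s ≠ s₀ → (m s).restrict (Set.Ioo (-δ) δ) = 0) :
    (∑ s ∈ S, m s).restrict (Set.Ioo (-δ) δ) =
      if s₀ ∈ S then (m s₀).restrict (Set.Ioo (-δ) δ) else 0 := by
  have hlin : (∑ s ∈ S, m s).restrict (Set.Ioo (-δ) δ) = ∑ s ∈ S, (m s).restrict (Set.Ioo (-δ) δ) := by
    rw [← Measure.restrictₗ_apply, map_sum]
    simp only [Measure.restrictₗ_apply]
  rw [hlin]
  split_ifs with h0
  · rw [← Finset.add_sum_erase S _ h0]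
    rw [Finset.sum_eq_zero (fun s hs => hfar s (Finset.mem_of_mem_erase hs) (Finset.ne_of_mem_erase hs)),
      add_zero]
  · exact Finset.sum_eq_zero (fun s hs => hfar s hs (fun h => h0 (h ▸ hs)))

/-- **The window density of "near + far".** If `m_near` has density `ρ` on the window `(−δ, δ)` and
`m_far` vanishes there, then `m_near + m_far` has density `ρ` on the window — the shape of the
hypothesis of `stub_freeForceKernel_of_windowDensity` / `tendstoLocallyUniformlyOn_abelCos_of_window`.
[folklore] -/
theorem window_density_of_near_add_far {m_near m_far : Measure ℝ} {δ : ℝ} {ρ : ℝ → ℝ}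
    (hnear : m_near.restrict (Set.Ioo (-δ) δ) =
      (volume.restrict (Set.Ioo (-δ) δ)).withDensity (fun x => ENNReal.ofReal (ρ x)))
    (hfar : m_far.restrict (Set.Ioo (-δ) δ) = 0) :
    (m_near + m_far).restrict (Set.Ioo (-δ) δ) =
      (volume.restrict (Set.Ioo (-δ) δ)).withDensity (fun x => ENNReal.ofReal (ρ x)) := by
  rw [Measure.restrict_add, hnear, hfar, add_zero]

/-- **The consumable corollary for the chaos spectral measure of an even quartic vector.** Let the
spectral measure be the sector sum `m = Σ_{s ∈ S} (Ω_s)_* ν_s` over labels with `cr + an ∈ {2,4}`, with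
NO one-phonon-charge component (`(1,1) ∉ S` or `ν_{(1,1)} = 0`: for the first-order force `Φ` of stub K
this is `[Φ]_{1,1} = 0`). Then for `0 < δ ≤ c(ω₂)` the window restriction of `m` is the window
restriction of the PAIR-SECTOR push-forward `(Ω_{2,2})_* ν_{(2,2)}` alone (or `0`): near frequency `0`
only the two-phonon threshold contributes. [folklore] -/
theorem restrict_window_sectorSum_eq_pair {ω₂ : ℝ} (hω : 0 < ω₂) (S : Finset SectorIndex)
    (ν : ∀ s : SectorIndex, Measure (Shell s.cr s.an))
    (hS : ∀ s ∈ S, s.cr + s.an = 2 ∨ s.cr + s.an = 4)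
    (h11 : ∀ s ∈ S, s.1 = (1, 1) → ν s = 0) {δ : ℝ}
    (hδ : δ ≤ 8 * ω₂ / (Real.sqrt (9 * ω₂ + 36) + Real.sqrt (ω₂ + 36))) :
    (∑ s ∈ S, (ν s).map (sectorPhase ω₂)).restrict (Set.Ioo (-δ) δ) =
      if (⟨(2, 2), by simp⟩ : SectorIndex) ∈ S then
        ((ν ⟨(2, 2), by simp⟩).map (sectorPhase ω₂)).restrict (Set.Ioo (-δ) δ) else 0 := by
  classical
  refine restrict_window_sum_far S (fun s => (ν s).map (sectorPhase ω₂)) ⟨(2, 2), by simp⟩ ?_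
  intro s hs hne
  by_cases h1 : s.1 = (1, 1)
  · simp only [h11 s hs h1, Measure.map_zero, Measure.restrict_zero]
  · have h22 : s.1 ≠ (2, 2) := fun h => hne (Subtype.ext h)
    exact map_sectorPhase_restrict_window_eq_zero hω s (hS s hs) h1 h22 (ν s) hδ

end Summit.AtomisticToContinuum.FouriersLaw.Theorems.DrudeDissolution.GramPencilHarmonicChaos

end
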